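import Literature.IUT.HodgeTheaters.GenuineFKitMergeInputsThetaSide
import HarnessLib

/-!
# Layer-5 certificate v0.20 — DISPLAY BLOCK E over a BUILT Literature module only: (M-6) the Θ-SIDE (m1) MODEL of the merge record
# (abc-iut-L5-lead RULINGS #139 R73 (ii) optional display «(M-6) Θ-side stand-in ★ p510136», deferred from BlocksD; standby CERT writer
# abc-iut-L5-t9 gen 8, row R73; LAYER5-CERT-SPEC.md §7)

PROOF-ONLY (no `def`, no `instance`, no `axiom`, no `sorry`, no `notation`); NO `Conditional` import.  DISPLAY/NV block, moves NO token.
Every theorem = a landed theorem of abc-iut-L2-t7 gen 10's `GenuineFKitMergeInputsThetaSide` (★ p510136) VERBATIM (section variables spelled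
in), proof BY NAME:
* `layer5_display_sec5_v20_thetaSide_standIn_theta_ne_one` := `InitialThetaData.frobeniusBadAt_thetaTowerStandIn_theta_ne_one` — at the
  X̲→-STAND-IN merge record with the [EtTh]-content (m1) slot read at a theta-tower covering `A₀` (`mergeInputsThetaTowerStandIn hA CG hTFG A₀`:
  SAME (m2)/(m4) as the record of record `mergeInputsStandIn`), the GENUINE [IUTchI] Ex 3.2 bad local Frobenioid `frobeniusBadAt … x hx`
  has `Θ̲_v̲ ≠ 1` at every bad index;
* `layer5_nv_sec5_v20_thetaSide_standIn` := `InitialThetaData.exists_mergeInputs_standIn_frobeniusBadAt_theta_ne_one` (the HEADLINE of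
  ★ p510136: for every covering `Y_n` a merge record with the SAME (m2) as `mergeInputsStandIn` and `Θ̲_v̲ ≠ 1` at EVERY bad index — binders
  `hA`, `CG`, F-0240 `hTFG` only);
* `layer5_nv_sec5_v20_thetaSide_of_isClosed` := `InitialThetaData.exists_mergeInputs_of_isClosed_frobeniusBadAt_theta_ne_one` (the same
  at EVERY CLOSED bad-pair family `B`).
LABEL (travels, abc-iut-L2-t7's verbatim): «[m1 MODEL v2 AT A GENUINE BAD INDEX: genuine `K_v̲`, `G_v̲`, `q̲_v̲`, the pair's own `Π`; the
`ℱ̲_v̲`/`𝒞_v̲`-summands = the ε-free theta tower's [EtTh] Def. 3.6 (ii) category + base-field-theoretic hull read at ONE covering `A₀`,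
CONSTANT over `𝒟_v̲`; `ℱ÷_v̲` = birationalization STAND-IN; `Θ̲_v̲` = the generator of the tower's Θ̈-Kummer COORDINATE group, NOT print's
Kummer class; it is NOT the tempered Frobenioid of the Tate curve (IUTchI:Ex3.2(i) = FOUNDATIONS-BOUNDARY HOLD, GAP G-L5-EX32I-1 —
UNCHANGED)]».  Mochizuki, *Inter-universal Teichmüller theory I* [cite: Mochizuki2012] (D-0012 claim key; series status DISPUTED): Ex 3.2
(i)–(v) pp.69–73, Def 5.2 (i)–(iv) pp.134–135.  HONEST FRAMING: a MODEL inhabitant witnesses OUR binders only; no token moves by this file;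
nothing here asserts that abc is proved or refuted or takes a side on [IUTchIII] Cor. 3.12; typed ≠ inhabited ≠ discharged; indexed ≠ endorsed.
-/

namespace Summit.ABC.IUTFork.Conditional

open CategoryTheory Opposite Literature.IUT.HodgeTheaters
open Literature.AnabelianGeometry.SemiGraphs Literature.AlgebraicGeometry.Frobenioids
  Literature.AlgebraicGeometry.Frobenioids.PadicFrd Literature.AnabelianGeometry.EtaleTheta

noncomputable section BlocksEV20

/-- **(M-6, display) — `Θ̲_v̲ ≠ 1` in the GENUINE Ex. 3.2 bad local Frobenioid of the X̲→-stand-in kit at every bad index, with the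
Θ-side (m1) MODEL record** `mergeInputsThetaTowerStandIn hA CG hTFG A₀` (★ p510136 `InitialThetaData.frobeniusBadAt_thetaTowerStandIn_theta_ne_one`).
«[stand-in record; m1 MODEL v2 — LABELLED; no token]» [cite: Mochizuki2012, IUTchI Ex 3.2 (ii) p.70] [claim: Mochizuki2012, status: disputed] -/
theorem layer5_display_sec5_v20_thetaSide_standIn_theta_ne_one
    {F K Fbar : Type} [Field F] [NumberField F] [Field K] [NumberField K] [Algebra F K]
    [Field Fbar] [Algebra F Fbar] [Algebra K Fbar] {E : WeierstrassCurve F}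
    [E.IsElliptic] {l : ℕ} {Pb : BadPlacePredicates K} (D : InitialThetaData F K Fbar E l Pb)
    (hA : D.geom.pe.ArrowCoveringClaims) (CG : D.geom.pe.CuspGalois) (hTFG : D.geom.extF.GeomTFG)
    (A₀ : ConnectedPart (BTemp TateTowerKummerTwistRShear.Compat₃')) (x : D.IndexCopy) (hx : x ∈ D.indexCopyBad)
    [Fact (D.primeAt x (D.not_mem_arc_of_mem_bad hx)).Prime] :
    (D.frobeniusBadAt _ (D.mergeInputsThetaTowerStandIn hA CG hTFG A₀) x hx).theta ≠ 1 :=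
  D.frobeniusBadAt_thetaTowerStandIn_theta_ne_one hA CG hTFG A₀ x hx

/-- **(M-6, NV) — the HEADLINE of ★ p510136** (`InitialThetaData.exists_mergeInputs_standIn_frobeniusBadAt_theta_ne_one`): at the X̲→-stand-in
kit and every covering `Y_n` of the theta tower there is a merge record with the SAME (m2) as `mergeInputsStandIn` whose GENUINE Ex. 3.2 bad
local Frobenioid has `Θ̲_v̲ ≠ 1` at EVERY bad index — binders `hA`, `CG`, F-0240 `hTFG` only.  «[MODEL datum, labelled; NV column]»
[cite: Mochizuki2012, IUTchI Def 5.2 (i) p.134] [claim: Mochizuki2012, status: disputed] -/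
theorem layer5_nv_sec5_v20_thetaSide_standIn
    {F K Fbar : Type} [Field F] [NumberField F] [Field K] [NumberField K] [Algebra F K]
    [Field Fbar] [Algebra F Fbar] [Algebra K Fbar] {E : WeierstrassCurve F}
    [E.IsElliptic] {l : ℕ} {Pb : BadPlacePredicates K} (D : InitialThetaData F K Fbar E l Pb)
    (hA : D.geom.pe.ArrowCoveringClaims) (CG : D.geom.pe.CuspGalois) (hTFG : D.geom.extF.GeomTFG) (n : ℕ) :
    ∃ I : D.MergeInputs fun v _ => D.badPairAtArrow hA v,
      I.m2 = (D.mergeInputsStandIn hA CG hTFG).m2 ∧ ∀ x (hx : x ∈ D.indexCopyBad) [Fact (D.primeAt x (D.not_mem_arc_of_mem_bad hx)).Prime],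
        (D.frobeniusBadAt _ I x hx).theta ≠ 1 :=
  D.exists_mergeInputs_standIn_frobeniusBadAt_theta_ne_one hA CG hTFG n

/-- **(M-6, NV′) — the same at EVERY CLOSED bad-pair family** (★ p510136 `InitialThetaData.exists_mergeInputs_of_isClosed_frobeniusBadAt_theta_ne_one`):
for `B` with every `(B x hx).H` closed and every covering `Y_n`, a merge record whose genuine Ex. 3.2 bad local Frobenioid has `Θ̲_v̲ ≠ 1` at every
bad index, from FACT F-0240 only.  «[closed-family NV; a GENUINE B = FOUNDATIONS 14; m1 MODEL v2 — LABELLED]»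
[cite: Mochizuki2012, IUTchI Def 5.2 (i) p.134] [claim: Mochizuki2012, status: disputed] -/
theorem layer5_nv_sec5_v20_thetaSide_of_isClosed
    {F K Fbar : Type} [Field F] [NumberField F] [Field K] [NumberField K] [Algebra F K]
    [Field Fbar] [Algebra F Fbar] [Algebra K Fbar] {E : WeierstrassCurve F}
    [E.IsElliptic] {l : ℕ} {Pb : BadPlacePredicates K} (D : InitialThetaData F K Fbar E l Pb)
    (B : ∀ v, v ∈ D.indexCopyBad → D.BadPairAt v) (hH : ∀ x (hx : x ∈ D.indexCopyBad), IsClosed ((B x hx).H : Set D.PiC))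
    (hTFG : D.geom.extF.GeomTFG) (n : ℕ) :
    ∃ I : D.MergeInputs B, ∀ x (hx : x ∈ D.indexCopyBad) [Fact (D.primeAt x (D.not_mem_arc_of_mem_bad hx)).Prime],
      (D.frobeniusBadAt B I x hx).theta ≠ 1 :=
  D.exists_mergeInputs_of_isClosed_frobeniusBadAt_theta_ne_one B hH hTFG n

end BlocksEV20

end Summit.ABC.IUTFork.Conditional

/-! ### Build-lane export guard (ops-buildfix bf1-g30, 2026-08-28; G11b-3 recipe v2 as in `GelbartRogawski1991/UnitaryDualPairSeesawCharacter`):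
the theorems of this file carry very large dependent telescopes; at `.olean` export Lean 4.32's library-suggestion indexers fold over
every local theorem statement and do not finish within the build lane's one-hour clock (measured on a farm node: `lean -o` > 1 500 s, plain
elaboration ≈ 20 s). ONE file-final `local` `[implicit_reducible]` keeps them out of that premise index (inert for Meta and the kernel on
theorems; no definition is tagged; statements and proofs unchanged). -/
set_option allowUnsafeReducibility true in
attribute [local implicit_reducible]
  _root_.Summit.ABC.IUTFork.Conditional.layer5_display_sec5_v20_thetaSide_standIn_theta_ne_one
  _root_.Summit.ABC.IUTFork.Conditional.layer5_nv_sec5_v20_thetaSide_standIn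
  _root_.Summit.ABC.IUTFork.Conditional.layer5_nv_sec5_v20_thetaSide_of_isClosed
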